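import Summits.ResolutionOfSingularities.ResolutionOfSingularities.Theorems.WildPurityWildSymbolSymbolCalculus
import HarnessLib

/-!
# `WildSymbol` (stmt-ResolutionOfSingularities-17133), line `birth` — condition (D) depends only on the
# local ring of the point: (D) ⇔ "`α` is integral at every divisorial place CONTAINING `locAt R O`"

Support file for crux #2 of route `ResolutionOfSingularities/WildPurity`
(`Summit.ResolutionOfSingularities.ResolutionOfSingularities.Theses.WildPurity.WildSymbol`), line `birth`
(definitions `Theorems/WildPurityWildSymbolBirthDefs.lean`). Registered sub-goal `divIntegral_iff_locAt`.

Condition (D) of the crux tests the divisorial valuation rings `W ⊇ R` (DVR, `k ⊆ W`, essentially of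
finite type over `k`) whose centre on `R` lies inside the centre of `O` (`𝔪_W ∩ R ⊆ 𝔪_O ∩ R`). For a
valuation ring `W` the pair of conditions "`R ⊆ W` and `𝔪_W ∩ R ⊆ 𝔪_O ∩ R`" is EQUIVALENT to the single
inclusion `locAt R O ⊆ W` (`le_locAt`, `locAt_le_of_centre`, `centre_of_locAt_le`): the elements of `R`
outside the centre of `O` are exactly the denominators of `locAt R O`, and they are units of `W` iff their
inverses lie in `W`. Hence

* `divIntegral_iff_locAt` — `DivIntegral p k K R O α ↔ ∀ W` divisorial with `locAt R O ≤ W`, `α ∈ Unr W`.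

Consequences recorded for the line (lead's notes): (D) is a property of the pair `(S, α)` with
`S = locAt R O` alone ("`α` is divisorially integral over the point"); in a periodic tower it is
automatically inherited by every level `σⁿ(S) ⊇ S` and, by `σ`-invariance of `α`, it forces integrality
at every divisorial place containing some LOWER level `σ⁻ⁿ(S)` — geometrically, at every prime divisor
centred on the backward orbit of the point under the contracting map `Spec σ⁻¹`, in particular along the
hypersurfaces it contracts into the point.

No definition is declared; nothing concludes the crux positively.
-/

noncomputable section

-- single-problem summit: the doubled namespace component `ResolutionOfSingularities` is forced
set_option linter.dupNamespace false

namespace Summit.ResolutionOfSingularities.ResolutionOfSingularities.Theorems.WildSymbol.Birth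

variable {k K : Type} [Field k] [Field K] [Algebra k K]

/-- The affine model lies in its local ring at the centre of `O`: `R ⊆ locAt R O`. [folklore] -/
theorem le_locAt (R : Subalgebra k K) (O : ValuationSubring K) :
    R.toSubring ≤ locAt (R : Set K) O := by
  intro x hx
  refine Subring.subset_closure ⟨x, 1, hx, R.one_mem, ?_, mul_one x⟩
  rw [ValuationSubring.mem_nonunits_iff, map_one]
  exact lt_irrefl 1

/-- If `R ⊆ W` and the centre of `W` on `R` lies inside the centre of `O`, then `locAt R O ⊆ W`: every
denominator of `locAt R O` is a unit of `W`. [folklore] -/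
theorem locAt_le_of_centre (R : Subalgebra k K) (O W : ValuationSubring K)
    (hRW : R.toSubring ≤ W.toSubring) (hcen : ∀ x : K, x ∈ R → x ∈ W.nonunits → x ∈ O.nonunits) :
    locAt (R : Set K) O ≤ W.toSubring := by
  refine Subring.closure_le.mpr ?_
  rintro x ⟨r, s, hr, hs, hsO, hx⟩
  have hsW : s ∉ W.nonunits := fun h => hsO (hcen s hs h)
  have hs0 : s ≠ 0 := ne_zero_of_not_mem_nonunits W hsW
  have hx' : x = r * s⁻¹ := by rw [← hx, mul_assoc, mul_inv_cancel₀ hs0, mul_one]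
  rw [hx']
  exact W.mul_mem _ _ (hRW hr) (inv_mem_of_not_mem_nonunits W hsW)

/-- Conversely, if `locAt R O ⊆ W` then the centre of `W` on `R` lies inside the centre of `O`: an
element of `R` outside the centre of `O` is inverted in `locAt R O ⊆ W`, so it is not a non-unit of `W`.
[folklore] -/
theorem centre_of_locAt_le (R : Subalgebra k K) (O W : ValuationSubring K)
    (hle : locAt (R : Set K) O ≤ W.toSubring) :
    ∀ x : K, x ∈ R → x ∈ W.nonunits → x ∈ O.nonunits := by
  intro x hxR hxW
  by_contra hxO
  have hx0 : x ≠ 0 := ne_zero_of_not_mem_nonunits O hxO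
  have hinv : x⁻¹ ∈ locAt (R : Set K) O :=
    Subring.subset_closure ⟨1, x, R.one_mem, hxR, hxO, inv_mul_cancel₀ hx0⟩
  have hinvW : x⁻¹ ∈ W := hle hinv
  rcases (ValuationSubring.mem_nonunits_iff_or (A := W)).mp hxW with h | h
  · exact hx0 h
  · exact h hinvW

/-- **(D) depends only on the local ring of the point.** Condition (D) of the crux (`α` integral at
every divisorial `W ⊇ R` with centre inside the centre of `O`) is equivalent to: `α` is integral at every
divisorial valuation ring `W` (DVR, `k ⊆ W`, essentially of finite type over `k`) CONTAINING
`locAt R O`. [folklore] -/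
theorem divIntegral_iff_locAt (p : ℕ) (R : Subalgebra k K) (O : ValuationSubring K) (α : G K ⧸ N p K) : DivIntegral p k K R O α ↔ ∀ W : ValuationSubring K, (∀ c : k, algebraMap k K c ∈ W) → IsDiscreteValuationRing W → EssFiniteType k K W → locAt (R : Set K) O ≤ W.toSubring → α ∈ Unr p K W.toSubring := by
  constructor
  · intro h W hk hdvr heft hle
    exact h W hk hdvr heft (le_trans (le_locAt R O) hle) (centre_of_locAt_le R O W hle)
  · intro h W hk hdvr heft hRW hcen
    exact h W hk hdvr heft (locAt_le_of_centre R O W hRW hcen)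

end Summit.ResolutionOfSingularities.ResolutionOfSingularities.Theorems.WildSymbol.Birth

end
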